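import Mathlib.Analysis.InnerProductSpace.PiL2
import Literature.Computability.QuantumComplexity.DecisionTreeSimulation
import HarnessLib

/-!
# Quantum query algorithms simulate randomized decision trees: `Q_ε(f) ≤ R_ε(f)`

Buhrman–de Wolf, *Complexity measures and decision tree complexity: a survey*, Theoret. Comput.
Sci. 288 (2002) 21–43, §3.3, p. 27: "a `T`-query deterministic decision tree can be simulated by
an exact `T`-query quantum algorithm. Similarly a `T`-query randomized decision tree can be
simulated by a `T`-query quantum decision tree with the same error probability (basically because
a superposition can 'simulate' a probability distribution). Accordingly, we have
`Q₂(f) ≤ R₂(f) ≤ D(f) ≤ n` … for all `f`", for the tree's query model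
`Literature.Computability.Cryptography.QQueryAlg` (`QuantumQuery.lean`) and the tree's randomized
decision trees (`PMF`s over `Literature.Computability.Complexity.DecisionTree`,
`DecisionTree.lean`: "a probability distribution `μ` over deterministic decision trees … the
complexity … is the depth of the deepest `T` that has `μ(T) > 0`", §3.2).

**The printed construction** (p. 27, deterministic case). "The basis states of the
corresponding quantum algorithm have the form `|i; b; h; a⟩`, where `i; b` is the query-part,
`h` ranges over all possible histories of the classical computation …. Let `U₀` map the initial
state … to `|i; 0; 0; 0⟩`, where `x_i` is the first variable that the classical tree would
query. Now, the quantum algorithm applies `O`, which turns the state into `|i; x_i; 0; 0⟩`. Then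
the algorithm applies a transformation `U₁` that maps `|i; x_i; 0; 0⟩` to `|j; 0; h; 0⟩`, where
`h` is the new history (which includes `i` and `x_i`) and `x_j` is the variable that the
classical tree would query given the outcome of the previous query …. All operations `U_i`
performed here are injective mappings from basis states to basis states, hence they can be
extended to permutations of basis states, which are unitary transformations."

**This file** is the randomized layer on top of `DecisionTreeSimulation.lean`, which carries
out the deterministic simulation (`DetTreeSim.simAlg`, discharging `Q_E(f) ≤ D(f)`) and whose
path API is reused here as is: `DetTreeSim.walk T r j` (the subtree reached after the first `j`
answers of a history `r : Fin d → Bool`), `DetTreeSim.rootVar` (the variable queried at a root,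
`0` at a leaf), `DetTreeSim.walk_update`, `DetTreeSim.eval_child_rootVar`,
`DetTreeSim.depth_walk_le`. What is new: the workspace is `S × (Fin d → Bool)` — a *tree
register* holding the sampled tree `T ∈ S` (a finite set of trees of depth `≤ d` containing the
support of the randomized tree; bounded-depth trees are finite in number,
`RandTreeSim.finite_setOf_depth_le`) next to the history register — and the bookkeeping
permutation `RandTreeSim.stepPerm k` reads `T` from the register (swap the target bit with
history slot `k`, then transpose the old and new root variables of branch `T`,
`RandTreeSim.stepPerm_queryMap_bstate`); `U₀` is a unitary whose column at the start state is
the superposition `∑_T √μ(T) |rootVar T, 0, T, 0…0⟩` (`exists_unitary_mulVec_single_eq`: any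
unit vector is a column of a unitary, from Mathlib's extension of an orthonormal family to an
orthonormal basis — the "superposition simulating a probability distribution"). Branchwise the
evolution is the deterministic one, so the final state is `∑_T √μ(T) |i_T, 0, T, h_T⟩` with the
walk of `T` along `h_T` ending at the leaf `T(x)` (`RandTreeSim.finalState_alg`), and accepting
iff that leaf is `1` gives acceptance probability `μ{T | T(x) = 1}` (`RandTreeSim.acceptProb_alg`,
`exists_queries_eq_acceptProb_eq`). Hence `quantumQueryComplexityOn_le_randQueryComplexityOn`
(`Q_ε ≤ R_ε` on every promise set, every `0 ≤ ε`: "with the same error probability"),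
`quantumQueryComplexity_le_randQueryComplexity_of_nonneg`, and the discharge
`quantumQueryComplexity_le_randQueryComplexity_holds` of the named fact
`quantumQueryComplexity_le_randQueryComplexity` (**quantum-advantage.S09**, `ε = 1/3`) of
`QueryComplexity.lean`.

The two `PMF` bookkeeping lemmas `toReal_toOuterMeasure_eq_sum` (mass of an event as a finite
sum over a finite set carrying the support) and `toReal_toOuterMeasure_add_compl` are folklore
with local copies elsewhere in the tree (`Cryptography/LubyRackoffIdeal.lean`
`toReal_toOuterMeasure_eq_sum`, `Fintype` form; `Cryptography/OracleAdversaryDecider.lean`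
`toReal_toOuterMeasure_compl`; `Barriers/PneNP/LowDegreeCounterexamplesNoise.lean` and
`Cryptography/LWESearchToDecisionTest.lean` `toOuterMeasure_add_compl`) — refactor: hoist all of
them next to `PMF.toOuterMeasure_apply`. Mathlib supplies `Matrix.permMatrix_mulVec`,
`Matrix.unitaryGroup`, `PMF`, orthonormal bases; the tree supplies `foldl_invariant`,
`queryOracle_mulVec_apply` (`PolynomialMethod.lean`) and `permMatrix_mem_unitaryGroup`
(`QuantumCircuit.lean`).

## References

* H. Buhrman, R. de Wolf, *Complexity measures and decision tree complexity: a survey*,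
  Theoret. Comput. Sci. 288 (2002) 21–43, §3.2 (randomized trees), §3.3, p. 27 (the
  simulation) (doi:10.1016/S0304-3975(01)00144-X) [Wolf2002].
* R. Beals, H. Buhrman, R. Cleve, M. Mosca, R. de Wolf, *Quantum lower bounds by polynomials*,
  J. ACM 48 (2001) 778–797, §3 [BealsEtAl2001].
-/

namespace Literature.Computability.QuantumComplexity

open Matrix Finset Literature.Computability.Cryptography Literature.Computability.Complexity

/-! ### Two more facts about walks in decision trees -/

namespace DetTreeSim

variable {N d : ℕ}

/-- After at least `depth T` steps a walk has reached a leaf, labelled by the value it computes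
(the bounded-depth form of `walk_depth_eq_leaf`). [cite: Wolf2002, §3.3, p. 27] -/
theorem walk_eq_leaf_of_depth_le (T : DecisionTree N) (r : Fin d → Bool) {k : ℕ}
    (hk : T.depth ≤ k) (x : Fin N → Bool) : walk T r k = .leaf ((walk T r k).eval x) := by
  have h0 := depth_walk_le T r k
  have h0' : (walk T r k).depth = 0 := by omega
  cases hw : walk T r k with
  | leaf c => rfl
  | query i t₀ t₁ => simp [hw] at h0'

end DetTreeSim

namespace RandTreeSim

/-- There are only finitely many decision trees of depth at most `d` on `n` variables (so the
support of a randomized decision tree of depth `≤ d` is finite). [folklore] -/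
theorem finite_setOf_depth_le (n d : ℕ) : {T : DecisionTree n | T.depth ≤ d}.Finite := by
  induction d with
  | zero =>
    refine (Set.finite_range DecisionTree.leaf).subset ?_
    rintro (b | ⟨i, t₀, t₁⟩) hT
    · exact ⟨b, rfl⟩
    · simp at hT
  | succ d ih =>
    refine ((Set.finite_range DecisionTree.leaf).union
      ((Set.finite_univ.prod (ih.prod ih)).image
        (fun p : Fin n × DecisionTree n × DecisionTree n =>
          DecisionTree.query p.1 p.2.1 p.2.2))).subset ?_
    rintro (b | ⟨i, t₀, t₁⟩) hT
    · exact Or.inl ⟨b, rfl⟩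
    · have hT' : max t₀.depth t₁.depth + 1 ≤ d + 1 := hT
      obtain ⟨h₀, h₁⟩ := max_le_iff.mp (Nat.add_le_add_iff_right.mp hT')
      exact Or.inr ⟨(i, t₀, t₁), ⟨Set.mem_univ _, h₀, h₁⟩, rfl⟩

/-! ### A unitary with a prescribed column -/

/-- Every unit vector is the column of some unitary matrix: for `∑_i ‖v_i‖² = 1` there is
`U ∈ U(B)` with `U e_s = v` (extend the orthonormal family `{v}` to an orthonormal basis of
`ℂ^B`, Mathlib `Orthonormal.exists_orthonormalBasis_extension_of_card_eq`, and take the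
change-of-basis matrix from the standard basis). This is the fact behind "let `U₀` map the
initial state to" an arbitrary prescribed unit vector. [folklore] -/
theorem exists_unitary_mulVec_single_eq {B : Type*} [Fintype B] [DecidableEq B] (s : B)
    (v : B → ℂ) (hv : ∑ i, ‖v i‖ ^ 2 = 1) :
    ∃ U : Matrix.unitaryGroup B ℂ, (U : Matrix B B ℂ) *ᵥ Pi.single s 1 = v := by
  have hw : ‖(WithLp.toLp 2 v : EuclideanSpace ℂ B)‖ = 1 := by
    rw [EuclideanSpace.norm_eq]
    simp [hv]
  have hon : Orthonormal ℂ (({s} : Set B).restrict fun _ : B =>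
      (WithLp.toLp 2 v : EuclideanSpace ℂ B)) := by
    rw [orthonormal_subsingleton_iff]
    intro _
    exact hw
  obtain ⟨b, hb⟩ := Orthonormal.exists_orthonormalBasis_extension_of_card_eq (𝕜 := ℂ)
    (E := EuclideanSpace ℂ B) finrank_euclideanSpace hon
  refine ⟨⟨(EuclideanSpace.basisFun B ℂ).toBasis.toMatrix b,
    (EuclideanSpace.basisFun B ℂ).toMatrix_orthonormalBasis_mem_unitary b⟩, ?_⟩
  funext i
  rw [Matrix.mulVec_single_one]
  simp [Matrix.col, Module.Basis.toMatrix_apply, hb s (Set.mem_singleton s)]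

/-! ### The simulating algorithm -/

variable {N : ℕ} (d : ℕ) (S : Finset (DecisionTree N))

/-- The computational basis of the simulating algorithm: index register, target qubit, and the
workspace `S × (Fin d → Bool)` — tree register and history register ("`|i; b; h; a⟩`", with
the sampled tree recorded alongside the history). [cite: Wolf2002, §3.3, p. 27] -/
abbrev QBasis : Type := Fin N × Bool × (↥S × (Fin d → Bool))

variable {d S} in
/-- Step (1) after the `(k+1)`-th query: swap the target bit with history slot `k`,
`(i, b, T, r) ↦ (i, r k, T, r[k := b])` (the tree-register form of `DetTreeSim.recPerm`).
[cite: Wolf2002, §3.3, p. 27] -/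
def recStep (k : Fin d) (s : QBasis d S) : QBasis d S :=
  (s.1, s.2.2.2 k, s.2.2.1, Function.update s.2.2.2 k s.2.1)

variable {d S} in
/-- Step (2): transpose, in the index register, the variables queried by branch `T` after `k`
and after `k + 1` recorded answers (the tree-register form of `DetTreeSim.idxPerm`; it depends
only on the workspace). [cite: Wolf2002, §3.3, p. 27] -/
def idxStep [NeZero N] (k : ℕ) (s : QBasis d S) : QBasis d S :=
  (Equiv.swap (DetTreeSim.rootVar (DetTreeSim.walk s.2.2.1.1 s.2.2.2 k))
    (DetTreeSim.rootVar (DetTreeSim.walk s.2.2.1.1 s.2.2.2 (k + 1))) s.1, s.2)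

variable {d S}

/-- Recording twice restores the registers. [cite: Wolf2002, §3.3, p. 27] -/
theorem recStep_involutive (k : Fin d) : Function.Involutive (recStep (d := d) (S := S) k) := by
  rintro ⟨i, b, T, h⟩
  simp [recStep]

/-- A transposition of the index register is an involution. [cite: Wolf2002, §3.3, p. 27] -/
theorem idxStep_involutive [NeZero N] (k : ℕ) :
    Function.Involutive (idxStep (d := d) (S := S) k) := by
  rintro ⟨i, b, T, h⟩
  simp [idxStep, Equiv.swap_apply_self]

/-- The bookkeeping permutation applied after the `(k+1)`-th query ("a transformation that
updates the workspace and determines the next query"): record, then re-aim the index register.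
[cite: Wolf2002, §3.3, p. 27] -/
def stepPerm [NeZero N] (k : Fin d) : Equiv.Perm (QBasis d S) :=
  ((recStep_involutive k).toPerm _).trans ((idxStep_involutive (k : ℕ)).toPerm _)

/-- Unfolding lemma for `stepPerm`. [cite: Wolf2002, §3.3, p. 27] -/
theorem stepPerm_apply [NeZero N] (k : Fin d) (s : QBasis d S) :
    stepPerm k s = idxStep k (recStep k s) :=
  rfl

/-- The bookkeeping steps fix the tree register. [cite: Wolf2002, §3.3, p. 27] -/
theorem stepPerm_apply_tree [NeZero N] (k : Fin d) (s : QBasis d S) :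
    (stepPerm k s).2.2.1 = s.2.2.1 :=
  rfl

/-- So does the inverse bookkeeping permutation. [cite: Wolf2002, §3.3, p. 27] -/
theorem stepPerm_symm_apply_tree [NeZero N] (k : Fin d) (s : QBasis d S) :
    ((stepPerm (S := S) k).symm s).2.2.1 = s.2.2.1 := by
  rw [← stepPerm_apply_tree k ((stepPerm k).symm s), Equiv.apply_symm_apply]

variable (d S)

/-- The basis state of branch `T` after `k` queries, given the family `r` of history registers:
`|rootVar (walk T (r T) k), 0, T, r T⟩`. [cite: Wolf2002, §3.3, p. 27] -/
def bstate [NeZero N] (r : ↥S → Fin d → Bool) (k : ℕ) (T : ↥S) : QBasis d S :=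
  (DetTreeSim.rootVar (DetTreeSim.walk T.1 (r T) k), false, T, r T)

/-- The state vector `∑_T amp(T) |bstate r k T⟩` (the branches are mutually orthogonal since `T`
is recorded in the workspace). [cite: Wolf2002, §3.3, p. 27] -/
def state [NeZero N] (amp : DecisionTree N → ℂ) (r : ↥S → Fin d → Bool) (k : ℕ) :
    QBasis d S → ℂ :=
  fun s => if s = bstate d S r k s.2.2.1 then amp s.2.2.1.1 else 0

variable {d S}

/-- The tree register of `bstate`. [cite: Wolf2002, §3.3, p. 27] -/
@[simp] theorem bstate_tree [NeZero N] (r : ↥S → Fin d → Bool) (k : ℕ) (T : ↥S) :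
    (bstate d S r k T).2.2.1 = T := rfl

/-- The amplitude of branch `T` on its own basis state. [cite: Wolf2002, §3.3, p. 27] -/
@[simp] theorem state_bstate [NeZero N] (amp : DecisionTree N → ℂ) (r : ↥S → Fin d → Bool)
    (k : ℕ) (T : ↥S) : state d S amp r k (bstate d S r k T) = amp T.1 := by
  simp [state]

/-- The history registers after one more round on input `x`: slot `k` of branch `T` receives the
answer `x_i`, `i` the variable queried by the subtree reached so far ("the new history").
[cite: Wolf2002, §3.3, p. 27] -/
def nextHist [NeZero N] (x : Fin N → Bool) (r : ↥S → Fin d → Bool) (k : Fin d) :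
    ↥S → Fin d → Bool :=
  fun T => Function.update (r T) k (x (DetTreeSim.rootVar (DetTreeSim.walk T.1 (r T) k)))

/-- **One round of the simulation**: if history slot `k` is still blank, the bookkeeping
permutation sends the post-query state `|i_k, x_{i_k}, T, h_k⟩` of branch `T` to
`|i_{k+1}, 0, T, h_{k+1}⟩` ("maps `|i; x_i; 0̃; 0⟩` to `|j; 0; h; 0⟩`, where `h` is the new
history"). [cite: Wolf2002, §3.3, p. 27] -/
theorem stepPerm_queryMap_bstate [NeZero N] (x : Fin N → Bool) (r : ↥S → Fin d → Bool)
    (k : Fin d) (hr : ∀ T, r T k = false) (T : ↥S) :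
    stepPerm k (queryMap x (bstate d S r k T)) = bstate d S (nextHist x r k) ((k : ℕ) + 1) T := by
  rw [stepPerm_apply]
  simp only [bstate, nextHist, queryMap_apply, recStep, idxStep, Bool.false_xor, hr T,
    DetTreeSim.walk_update, Equiv.swap_apply_left]

/-- The state evolves branchwise: `U_{k+1} O_x (state r k) = state (nextHist x r k) (k+1)`.
[cite: Wolf2002, §3.3, p. 27] -/
theorem stepPerm_mulVec_oracle_state [NeZero N] (amp : DecisionTree N → ℂ) (x : Fin N → Bool)
    (r : ↥S → Fin d → Bool) (k : Fin d) (hr : ∀ T, r T k = false) :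
    (Equiv.Perm.permMatrix ℂ (stepPerm k).symm) *ᵥ (queryOracle x *ᵥ state d S amp r k) =
      state d S amp (nextHist x r k) ((k : ℕ) + 1) := by
  funext s
  rw [Matrix.permMatrix_mulVec, Function.comp_apply, queryOracle_mulVec_apply]
  set u := (stepPerm k).symm s with hu
  have hT : (queryMap x u).2.2.1 = s.2.2.1 := stepPerm_symm_apply_tree k s
  rw [show (u.1, (u.2.1 ^^ x u.1), u.2.2) = queryMap x u from rfl]
  simp only [state]
  rw [hT]
  have hiff : queryMap x u = bstate d S r k s.2.2.1 ↔
      s = bstate d S (nextHist x r k) ((k : ℕ) + 1) s.2.2.1 := by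
    constructor
    · intro h
      have hu' : u = queryMap x (bstate d S r k s.2.2.1) := by
        rw [← h]
        exact (queryMap_involutive x u).symm
      calc s = stepPerm k u := ((stepPerm k).apply_symm_apply s).symm
        _ = bstate d S (nextHist x r k) ((k : ℕ) + 1) s.2.2.1 := by
          rw [hu', stepPerm_queryMap_bstate x r k hr]
    · intro h
      have hu' : u = queryMap x (bstate d S r k s.2.2.1) := by
        rw [hu, Equiv.symm_apply_eq, stepPerm_queryMap_bstate x r k hr]
        exact h
      rw [hu']
      exact queryMap_involutive x _
  by_cases h : s = bstate d S (nextHist x r k) ((k : ℕ) + 1) s.2.2.1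
  · rw [if_pos (hiff.mpr h), if_pos h]
  · rw [if_neg (fun h' => h (hiff.mp h')), if_neg h]

/-- Sums over the basis of a branchwise-supported function reduce to sums over the branches.
[folklore] -/
theorem sum_ite_eq_sum_branch (τ : ↥S → QBasis d S) (hτ : ∀ T, (τ T).2.2.1 = T)
    (g : QBasis d S → ℝ) :
    (∑ s, if s = τ s.2.2.1 then g s else 0) = ∑ T, g (τ T) := by
  have hinj : Function.Injective τ := fun T T' h => by rw [← hτ T, ← hτ T', h]
  rw [← Finset.sum_image (s := Finset.univ) (g := τ) (f := g) fun T _ T' _ h => hinj h,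
    ← Finset.sum_subset (Finset.subset_univ (Finset.univ.image τ))]
  · refine Finset.sum_congr rfl fun s hs => ?_
    obtain ⟨T, -, rfl⟩ := Finset.mem_image.mp hs
    rw [hτ T, if_pos rfl]
  · intro s _ hs
    rw [if_neg]
    intro h
    exact hs (Finset.mem_image.mpr ⟨s.2.2.1, Finset.mem_univ _, h.symm⟩)

/-- Every branchwise state vector has squared norm `∑_T |amp(T)|²`. [cite: Wolf2002, §3.3,
p. 27] -/
theorem sum_norm_sq_state [NeZero N] (amp : DecisionTree N → ℂ) (r : ↥S → Fin d → Bool)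
    (k : ℕ) : ∑ s, ‖state d S amp r k s‖ ^ 2 = ∑ T : ↥S, ‖amp T.1‖ ^ 2 :=
  calc ∑ s, ‖state d S amp r k s‖ ^ 2
      = ∑ s, if s = bstate d S r k s.2.2.1 then ‖amp s.2.2.1.1‖ ^ 2 else 0 := by
        refine Finset.sum_congr rfl fun s _ => ?_
        unfold state
        split_ifs <;> simp
    _ = ∑ T : ↥S, ‖amp T.1‖ ^ 2 := sum_ite_eq_sum_branch (bstate d S r k) (fun _ => rfl) _

variable (d S)

/-- The initial superposition `∑_T amp(T) |rootVar T, 0, T, 0…0⟩` (blank histories, no query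
made). [cite: Wolf2002, §3.3, p. 27] -/
def initVec [NeZero N] (amp : DecisionTree N → ℂ) : QBasis d S → ℂ :=
  state d S amp (fun _ _ => false) 0

/-- `U₀`: a unitary preparing the initial superposition from the start state `|0, 0, T₀, 0…0⟩`
("let `U₀` map the initial state to …"; "a superposition can 'simulate' a probability
distribution"). [cite: Wolf2002, §3.3, p. 27] -/
noncomputable def initUnitary [NeZero N] (amp : DecisionTree N → ℂ)
    (hamp : ∑ T : ↥S, ‖amp T.1‖ ^ 2 = 1) (T₀ : ↥S) : Matrix.unitaryGroup (QBasis d S) ℂ :=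
  Classical.choose (exists_unitary_mulVec_single_eq
    (((0 : Fin N), false, T₀, fun _ => false) : QBasis d S) (initVec d S amp)
    ((sum_norm_sq_state amp _ 0).trans hamp))

/-- `U₀ |0, 0, T₀, 0…0⟩ = ∑_T amp(T) |rootVar T, 0, T, 0…0⟩`. [cite: Wolf2002, §3.3, p. 27] -/
theorem initUnitary_mulVec [NeZero N] (amp : DecisionTree N → ℂ)
    (hamp : ∑ T : ↥S, ‖amp T.1‖ ^ 2 = 1) (T₀ : ↥S) :
    (initUnitary d S amp hamp T₀ : Matrix (QBasis d S) (QBasis d S) ℂ) *ᵥ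
        Pi.single (((0 : Fin N), false, T₀, fun _ => false) : QBasis d S) 1 = initVec d S amp :=
  Classical.choose_spec (exists_unitary_mulVec_single_eq
    (((0 : Fin N), false, T₀, fun _ => false) : QBasis d S) (initVec d S amp)
    ((sum_norm_sq_state amp _ 0).trans hamp))

/-- The unitaries `U₀, U₁, …, U_d` of the simulation: `U₀ = initUnitary`, and `U_{k+1}` the
permutation matrix realising `stepPerm k` on basis states. [cite: Wolf2002, §3.3, p. 27] -/
noncomputable def unitaries [NeZero N] (amp : DecisionTree N → ℂ)
    (hamp : ∑ T : ↥S, ‖amp T.1‖ ^ 2 = 1) (T₀ : ↥S) :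
    Fin (d + 1) → Matrix.unitaryGroup (QBasis d S) ℂ :=
  fun j => if h : j = 0 then initUnitary d S amp hamp T₀
    else ⟨Equiv.Perm.permMatrix ℂ (stepPerm (S := S) (j.pred h)).symm,
      permMatrix_mem_unitaryGroup (stepPerm (S := S) (j.pred h)).symm⟩

/-- `U₀ = initUnitary`. [cite: Wolf2002, §3.3, p. 27] -/
theorem unitaries_zero [NeZero N] (amp : DecisionTree N → ℂ)
    (hamp : ∑ T : ↥S, ‖amp T.1‖ ^ 2 = 1) (T₀ : ↥S) :
    unitaries d S amp hamp T₀ 0 = initUnitary d S amp hamp T₀ :=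
  dif_pos rfl

/-- `U_{k+1}` is the permutation matrix realising `stepPerm k`. [cite: Wolf2002, §3.3, p. 27] -/
theorem unitaries_succ [NeZero N] (amp : DecisionTree N → ℂ)
    (hamp : ∑ T : ↥S, ‖amp T.1‖ ^ 2 = 1) (T₀ : ↥S) (k : Fin d) :
    (unitaries d S amp hamp T₀ k.succ : Matrix (QBasis d S) (QBasis d S) ℂ) =
      Equiv.Perm.permMatrix ℂ (stepPerm (S := S) k).symm := by
  simp [unitaries]

/-- **The simulating algorithm** of a randomized decision tree with branch amplitudes `amp` on
the finite set of trees `S` (Buhrman–de Wolf 2002, §3.3, p. 27): `d` queries; `U₀` prepares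
`∑_T amp(T) |rootVar T, 0, T, 0…0⟩`; `U_{k+1}` is the permutation matrix of `stepPerm k`; accept
iff the walk of the recorded tree along the recorded history ends at the leaf `1` ("sets the
answer bit to 0 or 1 depending on its total history"). Reducible, so that the workspace and the
query count unfold in instance search. [cite: Wolf2002, §3.3, p. 27] -/
@[reducible] noncomputable def alg [NeZero N] (amp : DecisionTree N → ℂ)
    (hamp : ∑ T : ↥S, ‖amp T.1‖ ^ 2 = 1) (T₀ : ↥S) : QQueryAlg N where
  W := ↥S × (Fin d → Bool)
  queries := d
  unitaries := unitaries d S amp hamp T₀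
  start := ((0 : Fin N), false, T₀, fun _ => false)
  accept := {s | DetTreeSim.walk s.2.2.1.1 s.2.2.2 d = .leaf true}

variable {d S}

/-- The simulation stays branchwise in the computational basis: on input `x` the final state of
`alg` is `∑_T amp(T) |rootVar (walk T (r T) d), 0, T, r T⟩` for histories `r T` along which the
walk of `T` computes `T(x)` (round by round `DetTreeSim.eval_child_rootVar`, as in
`DetTreeSim.simAlg_finalState`). [cite: Wolf2002, §3.3, p. 27] -/
theorem finalState_alg [NeZero N] (amp : DecisionTree N → ℂ)
    (hamp : ∑ T : ↥S, ‖amp T.1‖ ^ 2 = 1) (T₀ : ↥S) (x : Fin N → Bool) :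
    ∃ r : ↥S → Fin d → Bool, (∀ T, (DetTreeSim.walk T.1 (r T) d).eval x = T.1.eval x) ∧
      (alg d S amp hamp T₀).finalState x = state d S amp r d := by
  have key : ∃ r : ↥S → Fin d → Bool,
      (∀ T (i : Fin d), (alg d S amp hamp T₀).queries ≤ i.val → r T i = false) ∧
      (∀ T, (DetTreeSim.walk T.1 (r T) (alg d S amp hamp T₀).queries).eval x = T.1.eval x) ∧
      (alg d S amp hamp T₀).finalState x = state d S amp r (alg d S amp hamp T₀).queries := by
    unfold QQueryAlg.finalState
    refine foldl_invariant (P := fun (j : ℕ) (ψ : QBasis d S → ℂ) =>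
        ∃ r : ↥S → Fin d → Bool, (∀ T (i : Fin d), j ≤ i.val → r T i = false) ∧
          (∀ T, (DetTreeSim.walk T.1 (r T) j).eval x = T.1.eval x) ∧ ψ = state d S amp r j)
      (alg d S amp hamp T₀).queries
      (fun ψ j => ((alg d S amp hamp T₀).unitaries j.succ).1 *ᵥ (queryOracle x *ᵥ ψ))
      (((alg d S amp hamp T₀).unitaries 0).1 *ᵥ Pi.single (alg d S amp hamp T₀).start 1)
      ?_ ?_
    · refine ⟨fun _ _ => false, fun _ _ _ => rfl, fun _ => rfl, ?_⟩
      show (unitaries d S amp hamp T₀ 0 : Matrix (QBasis d S) (QBasis d S) ℂ) *ᵥ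
          Pi.single (((0 : Fin N), false, T₀, fun _ => false) : QBasis d S) 1 = _
      rw [unitaries_zero, initUnitary_mulVec]
      rfl
    · rintro j ψ ⟨r, hr, hev, rfl⟩
      have hrj : ∀ T, r T j = false := fun T => hr T j le_rfl
      refine ⟨nextHist x r j, fun T i hi => ?_, fun T => ?_, ?_⟩
      · have hij : i ≠ j := by
          rintro rfl
          omega
        rw [nextHist, Function.update_of_ne hij]
        exact hr T i (by omega)
      · rw [DetTreeSim.walk_succ_of_lt T.1 _ j.isLt, Fin.eta, nextHist, Function.update_self,
          DetTreeSim.walk_update, DetTreeSim.eval_child_rootVar, hev]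
      · show (unitaries d S amp hamp T₀ j.succ : Matrix (QBasis d S) (QBasis d S) ℂ) *ᵥ
            (queryOracle x *ᵥ state d S amp r j) = state d S amp (nextHist x r j) ((j : ℕ) + 1)
        rw [unitaries_succ]
        exact stepPerm_mulVec_oracle_state amp x r j hrj
  obtain ⟨r, -, hev, hψ⟩ := key
  exact ⟨r, hev, hψ⟩

/-- Branch `T` is accepted iff `T` outputs `1` on `x` (for trees of depth `≤ d`: the walk has
reached the leaf `T(x)`, `DetTreeSim.walk_eq_leaf_of_depth_le`). [cite: Wolf2002, §3.3,
p. 27] -/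
theorem bstate_mem_accept_iff [NeZero N] (amp : DecisionTree N → ℂ)
    (hamp : ∑ T : ↥S, ‖amp T.1‖ ^ 2 = 1) (T₀ : ↥S) (x : Fin N → Bool)
    {r : ↥S → Fin d → Bool} (T : ↥S) (hT : T.1.depth ≤ d)
    (hev : (DetTreeSim.walk T.1 (r T) d).eval x = T.1.eval x) :
    bstate d S r d T ∈ (alg d S amp hamp T₀).accept ↔ T.1.eval x = true := by
  show DetTreeSim.walk T.1 (r T) d = .leaf true ↔ _
  rw [DetTreeSim.walk_eq_leaf_of_depth_le T.1 (r T) hT x, hev, DecisionTree.leaf.injEq]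

/-- **Acceptance probability of the simulation**: `Pr[accept x] = ∑_{T : T(x) = 1} |amp(T)|²`
("a superposition can 'simulate' a probability distribution"). [cite: Wolf2002, §3.3, p. 27] -/
theorem acceptProb_alg [NeZero N] (amp : DecisionTree N → ℂ)
    (hamp : ∑ T : ↥S, ‖amp T.1‖ ^ 2 = 1) (T₀ : ↥S) (hS : ∀ T ∈ S, T.depth ≤ d)
    (x : Fin N → Bool) :
    (alg d S amp hamp T₀).acceptProb x =
      ∑ T : ↥S, if T.1.eval x = true then ‖amp T.1‖ ^ 2 else 0 := by
  classical
  obtain ⟨r, hev, hψ⟩ := finalState_alg amp hamp T₀ x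
  unfold QQueryAlg.acceptProb
  rw [hψ, Finset.sum_filter]
  refine Eq.trans (Finset.sum_congr rfl fun s _ => ?_)
    (sum_ite_eq_sum_branch (bstate d S r d) (fun T => rfl)
      (fun s => if s.2.2.1.1.eval x = true then ‖amp s.2.2.1.1‖ ^ 2 else 0))
  by_cases h : s = bstate d S r d s.2.2.1
  · obtain ⟨T, hT⟩ : ∃ T, s = bstate d S r d T := ⟨_, h⟩
    subst hT
    have hmem := bstate_mem_accept_iff amp hamp T₀ x T (hS T.1 T.2) (hev T)
    simp only [bstate_tree, state_bstate, if_true]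
    by_cases he : T.1.eval x = true
    · rw [if_pos (hmem.mpr he), if_pos he]
    · rw [if_neg (fun hm => he (hmem.mp hm)), if_neg he]
  · rw [if_neg h]
    have h0 : state d S amp r d s = 0 := if_neg h
    rw [h0, norm_zero]
    simp

end RandTreeSim

/-! ### From randomized decision trees to quantum query algorithms -/

section Consequences

variable {N : ℕ}

/-- The mass a `PMF` whose support lies in a finite set `S` gives to a set `E`, as a finite sum
(local copy of folklore; siblings: `Cryptography/LubyRackoffIdeal.lean`
`toReal_toOuterMeasure_eq_sum` (`Fintype` form) — refactor: hoist next to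
`PMF.toOuterMeasure_apply`). [folklore] -/
theorem toReal_toOuterMeasure_eq_sum {α : Type*} (μ : PMF α) {S : Finset α}
    (hS : ∀ a, a ∉ S → μ a = 0) (E : Set α) :
    (μ.toOuterMeasure E).toReal = ∑ a ∈ S, E.indicator (fun a => (μ a).toReal) a := by
  rw [PMF.toOuterMeasure_apply,
    tsum_eq_sum (L := SummationFilter.unconditional _) (s := S) fun a ha => by simp [hS a ha],
    ENNReal.toReal_sum fun a _ => ?_]
  · refine Finset.sum_congr rfl fun a _ => ?_
    by_cases ha : a ∈ E
    · rw [Set.indicator_of_mem ha, Set.indicator_of_mem ha]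
    · rw [Set.indicator_of_notMem ha, Set.indicator_of_notMem ha, ENNReal.toReal_zero]
  · by_cases ha : a ∈ E
    · rw [Set.indicator_of_mem ha]
      exact PMF.apply_ne_top μ a
    · rw [Set.indicator_of_notMem ha]
      exact ENNReal.zero_ne_top

/-- Complementary events have total mass `1` under a `PMF` (local copy of folklore; siblings:
`Cryptography/OracleAdversaryDecider.lean` `toReal_toOuterMeasure_compl`,
`Barriers/PneNP/LowDegreeCounterexamplesNoise.lean` and
`Cryptography/LWESearchToDecisionTest.lean` `toOuterMeasure_add_compl` — refactor: hoist next to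
`PMF.toOuterMeasure_apply`). [folklore] -/
theorem toReal_toOuterMeasure_add_compl {α : Type*} (μ : PMF α) (E : Set α) :
    (μ.toOuterMeasure E).toReal + (μ.toOuterMeasure Eᶜ).toReal = 1 := by
  have h : μ.toOuterMeasure E + μ.toOuterMeasure Eᶜ = 1 := by
    rw [PMF.toOuterMeasure_apply, PMF.toOuterMeasure_apply, ← ENNReal.tsum_add]
    conv_rhs => rw [← μ.tsum_coe]
    refine tsum_congr fun a => ?_
    rw [← Pi.add_apply (E.indicator ⇑μ) (Eᶜ.indicator ⇑μ) a, Set.indicator_self_add_compl]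
  have hE : μ.toOuterMeasure E ≠ ⊤ := ne_top_of_le_ne_top ENNReal.one_ne_top (h ▸ le_self_add)
  have hEc : μ.toOuterMeasure Eᶜ ≠ ⊤ :=
    ne_top_of_le_ne_top ENNReal.one_ne_top (h ▸ le_add_self)
  rw [← ENNReal.toReal_add hE hEc, h, ENNReal.toReal_one]

/-- **Simulation of a randomized decision tree** (Buhrman–de Wolf 2002, §3.3, p. 27): a
probability distribution `μ` over decision trees of depth `≤ d` on `N ≥ 1` variables is simulated
by a `d`-query quantum algorithm whose acceptance probability on every input `x` is the
`μ`-probability that the sampled tree outputs `1` on `x`. [cite: Wolf2002, §3.3, p. 27] -/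
theorem exists_queries_eq_acceptProb_eq [NeZero N] (μ : PMF (DecisionTree N)) (d : ℕ)
    (hμ : ∀ T ∈ μ.support, T.depth ≤ d) :
    ∃ A : QQueryAlg N, A.queries = d ∧
      ∀ x, A.acceptProb x = (μ.toOuterMeasure {T | T.eval x = true}).toReal := by
  have hfin : μ.support.Finite :=
    (RandTreeSim.finite_setOf_depth_le N d).subset fun T hT => hμ T hT
  set S : Finset (DecisionTree N) := hfin.toFinset with hS_def
  have hS : ∀ T, T ∈ S ↔ T ∈ μ.support := fun T => hfin.mem_toFinset
  have hS0 : ∀ T, T ∉ S → μ T = 0 := fun T hT =>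
    (PMF.apply_eq_zero_iff μ T).2 fun h => hT ((hS T).2 h)
  obtain ⟨T₀, hT₀⟩ := μ.support_nonempty
  set amp : DecisionTree N → ℂ := fun T => ((Real.sqrt (μ T).toReal : ℝ) : ℂ) with hamp_def
  have hnorm : ∀ T, ‖amp T‖ ^ 2 = (μ T).toReal := fun T => by
    rw [hamp_def]
    dsimp only
    rw [Complex.norm_real, Real.norm_eq_abs, sq_abs, Real.sq_sqrt ENNReal.toReal_nonneg]
  have hsum : ∑ T ∈ S, (μ T).toReal = 1 := by
    rw [← ENNReal.toReal_sum fun T _ => PMF.apply_ne_top μ T,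
      ← tsum_eq_sum (L := SummationFilter.unconditional _) (s := S) fun T hT => hS0 T hT,
      PMF.tsum_coe, ENNReal.toReal_one]
  have hamp : ∑ T : ↥S, ‖amp T.1‖ ^ 2 = 1 := by
    simp_rw [hnorm]
    rw [Finset.sum_coe_sort S fun T => (μ T).toReal]
    exact hsum
  refine ⟨RandTreeSim.alg d S amp hamp ⟨T₀, (hS T₀).2 hT₀⟩, rfl, fun x => ?_⟩
  rw [RandTreeSim.acceptProb_alg amp hamp _ (fun T hT => hμ T ((hS T).1 hT)) x,
    toReal_toOuterMeasure_eq_sum μ hS0,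
    Finset.sum_coe_sort S fun T => if T.eval x = true then ‖amp T‖ ^ 2 else 0]
  refine Finset.sum_congr rfl fun T _ => ?_
  rw [hnorm, Set.indicator_apply]
  by_cases h : T.eval x = true <;> simp [h]

/-- Total and promise versions agree on `Set.univ` for randomized query complexity.
[cite: Wolf2002, §3.2] -/
theorem randQueryComplexity_eq_randQueryComplexityOn_univ (ε : ℝ) (f : (Fin N → Bool) → Bool) :
    randQueryComplexity ε f = randQueryComplexityOn ε Set.univ f := by
  simp [randQueryComplexity, randQueryComplexityOn]

/-- **`Q_ε(f) ≤ R_ε(f)` on every promise set, `0 ≤ ε`** (Buhrman–de Wolf 2002, §3.3, p. 27: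
"a `T`-query randomized decision tree can be simulated by a `T`-query quantum decision tree with
the same error probability"): an optimal randomized tree `μ` for `f` on `D` (the defining
infimum is attained, the Dirac randomized trees making it nonempty) is simulated query-for-query
by `exists_queries_eq_acceptProb_eq`, with acceptance probability `μ{T | T(x) = 1}`, which is
`≥ 1 - ε` if `f x = 1` and `= 1 - μ{T | T(x) = 0} ≤ ε` if `f x = 0`. For `N = 0` both sides are
`0`. [cite: Wolf2002, §3.3, p. 27] -/
theorem quantumQueryComplexityOn_le_randQueryComplexityOn {ε : ℝ} (hε : 0 ≤ ε)
    (D : Set (Fin N → Bool)) (f : (Fin N → Bool) → Bool) :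
    quantumQueryComplexityOn ε D f ≤ randQueryComplexityOn ε D f := by
  rcases Nat.eq_zero_or_pos N with rfl | hN
  · rw [quantumQueryComplexityOn_zero_left]
    exact Nat.zero_le _
  haveI : NeZero N := NeZero.of_pos hN
  obtain ⟨T₁, hT₁, -⟩ := DecisionTree.exists_computes_depth_le f
  have hne : {d | ∃ μ : PMF (DecisionTree N), (∀ T ∈ μ.support, T.depth ≤ d) ∧
      ∀ x ∈ D, 1 - ε ≤ (μ.toOuterMeasure {T | T.eval x = f x}).toReal}.Nonempty := by
    refine ⟨T₁.depth, PMF.pure T₁, fun T hT => ?_, fun x _ => ?_⟩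
    · rw [PMF.support_pure, Set.mem_singleton_iff] at hT
      rw [hT]
    · have hmem : T₁ ∈ {T : DecisionTree N | T.eval x = f x} := hT₁ x
      rw [PMF.toOuterMeasure_pure_apply, if_pos hmem, ENNReal.toReal_one]
      linarith
  obtain ⟨μ, hμd, hμ⟩ : randQueryComplexityOn ε D f ∈ {d | ∃ μ : PMF (DecisionTree N),
      (∀ T ∈ μ.support, T.depth ≤ d) ∧
        ∀ x ∈ D, 1 - ε ≤ (μ.toOuterMeasure {T | T.eval x = f x}).toReal} := Nat.sInf_mem hne
  obtain ⟨A, hAq, hA⟩ := exists_queries_eq_acceptProb_eq μ _ hμd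
  refine Nat.sInf_le ⟨A, hAq, fun x hx => ⟨fun hfx => ?_, fun hfx => ?_⟩⟩
  · rw [hA x]
    simpa [hfx] using hμ x hx
  · have hc : {T : DecisionTree N | T.eval x = true}ᶜ = {T | T.eval x = f x} := by
      ext T
      simp [hfx]
    have h1 := toReal_toOuterMeasure_add_compl μ {T : DecisionTree N | T.eval x = true}
    rw [hc] at h1
    have h2 := hμ x hx
    rw [hA x]
    linarith

/-- **`Q_ε(f) ≤ R_ε(f)` for total functions, `0 ≤ ε`** (Buhrman–de Wolf 2002, §3.3, p. 27,
"`Q₂(f) ≤ R₂(f)`" for `ε = 1/3`). [cite: Wolf2002, §3.3, p. 27] -/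
theorem quantumQueryComplexity_le_randQueryComplexity_of_nonneg {ε : ℝ} (hε : 0 ≤ ε)
    (f : (Fin N → Bool) → Bool) : quantumQueryComplexity ε f ≤ randQueryComplexity ε f := by
  rw [randQueryComplexity_eq_randQueryComplexityOn_univ]
  exact quantumQueryComplexityOn_le_randQueryComplexityOn hε Set.univ f

/-- **quantum-advantage.S09 (`Q₂(f) ≤ R(f)`), discharged** (Buhrman–de Wolf 2002, §3.3, p. 27:
"a `T`-query randomized decision tree can be simulated by a `T`-query quantum decision tree with
the same error probability … Accordingly, we have `Q₂(f) ≤ R₂(f) ≤ D(f) ≤ n`"): the named fact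
`quantumQueryComplexity_le_randQueryComplexity` of `QueryComplexity.lean` holds — the case
`ε = 1/3` of `quantumQueryComplexity_le_randQueryComplexity_of_nonneg`.
[cite: Wolf2002, §3.3, p. 27] -/
theorem quantumQueryComplexity_le_randQueryComplexity_holds :
    quantumQueryComplexity_le_randQueryComplexity (N := N) := fun f =>
  quantumQueryComplexity_le_randQueryComplexity_of_nonneg (by norm_num) f

end Consequences

end Literature.Computability.QuantumComplexity
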